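import Summits.HodgeConjecture.HodgeConjecture.Theorems.F0P3cStCharTSTransferOfLevi   -- ★ p849563 (LH6-p04 (g2)): `hon_of_levi`; brings ★ p849417 `conj_notMem_tsupport_of_not_on_G`, ★ `isDeltaTransferRel_of_on_off`
import HarnessLib

/-!
# F0 · P3c · line LH6 «StCharTS» — road (D) «DEEP-FL», brick «OFF-STRATUM-SUM»: the transfer reduction ★ `isLocalDeltaTransfer_of_on` ∕ ★ `isLocalDeltaTransfer_of_levi`
# with the single-shell support clause on `f^H` replaced by «every point of `tsupport f^H` is ON the stratum» — the form the refined test function `f^H₀ = Σ_j c_j 𝟙_{K_H u_j K_H}` meets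

Cell `pub/hodgecm-mathlib`, crux H413 = `stmt-HodgeConjecture-24833` (lane `--supports … --as helper`), route HCCMUnconditional; seat LH6-p04 (g3) = road (D) owner of record
(from 2026-09-02T06:21:20Z; spec ROAD-D v6 `F0/P3b/LH6-p03/g0/ROAD-D.status.v6.txt` → v7).  THEOREMS ONLY, sorry-free, ★-only imports; no definition ∕ instance ∕ notation ∕ named fact.
HONEST LABEL: HC_CM is proved only modulo the 7 printed citations (2 remaining: hLiu418 = stmt-HodgeConjecture-24832, h413 = stmt-HodgeConjecture-24833) until rung 0 closes; count-neutral
plumbing of road (D) (a step of the (D-c) HEAD «XIG-ASSEMBLY»).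

THE MATHEMATICS ([Rogawski1990, §4.3 (4.3.1) p. 43; §3.1 p. 19; §12.7 L. 12.7.3 (proof) p. 195]).  Call `γ_H = (h₂, h₁) ∈ H_v` ON (the stratum) when `|det h₂|_w < |tr h₂|_w²` at the
non-split place `w`; this depends only on the characteristic polynomial of `h₂`, hence is invariant under conjugation AND under stable conjugacy in `H_v` (§1).  ★
`isLocalDeltaTransfer_of_on` (p849417) proved «Δ-transfer ⇐ the identity ON the stratum» for an `f^H` whose support has first components in ONE hyperbolic shell `K₂ (z₂ a₂^{m₂}) K₂`,
using that clause only through «shell points are ON».  ROAD-D v6 CHANGE 1 replaced `f^H` by a finite sum over SEVERAL shells `K_H u_j K_H` (all ON), so §2 restates the reduction with the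
weaker, intrinsic hypothesis `hfHon : ∀ x ∈ tsupport f^H, ON(x)` (each summand's shell is ON by «SHELL-ON★»; a union of ON sets is ON), and §3 the Levi form (★ `hon_of_levi`): the Δ-transfer
of `(f^H, 𝟙_{K_n (z aᵐ) K_n})` follows from the `hlevi` identity of ★ `isLocalDeltaTransfer_of_levi` VERBATIM — the socket discharged by ★ `hlevi_of_closed_forms` (p849750).

* §1 `valued_det_lt_trace_sq_iff_of_charpoly_eq`, `valued_det_lt_trace_sq_conj_iff`, `valued_det_lt_trace_sq_of_isLocalStablyConjH_iff`;
* §2 `conj_notMem_tsupport_of_not_on_H'`, **`isLocalDeltaTransfer_of_on'`**; §3 **`isLocalDeltaTransfer_of_levi'`**.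

## References
* [Rogawski1990] J. D. Rogawski, *Automorphic Representations of Unitary Groups in Three Variables*, Ann. of Math. Stud. 123 (1990): §3.1 p. 19; §4.3 (4.3.1) p. 43; §4.9
  p. 56; §12.7 Lemma 12.7.3 (proof) p. 195.
-/

set_option autoImplicit false
-- the mandated namespace has the single-problem summit's repeated segment (`HodgeConjecture.HodgeConjecture`)
set_option linter.dupNamespace false

noncomputable section

open Matrix Polynomial NumberField IsDedekindDomain
open scoped MatrixGroups
open Literature.NumberTheory.Rogawski1990 Literature.NumberTheory.Automorphic Literature.NumberTheory.Automorphic.UnitaryGroup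
open Literature.NumberTheory.GaloisRepresentations

namespace Summit.HodgeConjecture.HodgeConjecture.Cruxes.H413.F0P3cStCharTSOffStratumSum

variable (L : Type) [Field L] [NumberField L] [IsCMField L] (v : HeightOneSpectrum (𝓞 ↥(maximalRealSubfield L)))
  (w : PlacesOver L v) (hw : IsCMField.complexConj L • w.1 = w.1)

/-! ## §1 ON the stratum is a function of the characteristic polynomial of `h₂` -/

omit [IsCMField L] in
/-- If `h₂, h₂′ ∈ GL₂(L ⊗ L⁺_v)` have the same characteristic polynomial then `|det h₂|_w < |tr h₂|_w² ↔ |det h₂′|_w < |tr h₂′|_w²` (read at `w` through `charpoly_map`,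
`det`∕`trace` = coefficients). [cite: Rogawski1990, §3.1 p. 19; §4.9 p. 56] -/
theorem valued_det_lt_trace_sq_iff_of_charpoly_eq {M N : GL (Fin 2) (LocalRing L v)}
    (h : (M : Matrix (Fin 2) (Fin 2) (LocalRing L v)).charpoly = (N : Matrix (Fin 2) (Fin 2) (LocalRing L v)).charpoly) :
    Valued.v ((Pi.evalRingHom (fun w' : PlacesOver L v => w'.1.adicCompletion L) w) (M : Matrix (Fin 2) (Fin 2) (LocalRing L v)).det) <
        Valued.v ((Pi.evalRingHom (fun w' : PlacesOver L v => w'.1.adicCompletion L) w) (M : Matrix (Fin 2) (Fin 2) (LocalRing L v)).trace) ^ 2 ↔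
      Valued.v ((Pi.evalRingHom (fun w' : PlacesOver L v => w'.1.adicCompletion L) w) (N : Matrix (Fin 2) (Fin 2) (LocalRing L v)).det) <
        Valued.v ((Pi.evalRingHom (fun w' : PlacesOver L v => w'.1.adicCompletion L) w) (N : Matrix (Fin 2) (Fin 2) (LocalRing L v)).trace) ^ 2 := by
  set ev := Pi.evalRingHom (fun w' : PlacesOver L v => w'.1.adicCompletion L) w with hev
  have hc : ((M : Matrix (Fin 2) (Fin 2) (LocalRing L v)).map ev).charpoly = ((N : Matrix (Fin 2) (Fin 2) (LocalRing L v)).map ev).charpoly := by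
    rw [Matrix.charpoly_map, Matrix.charpoly_map, h]
  have hdet : ((M : Matrix (Fin 2) (Fin 2) (LocalRing L v)).map ev).det = ((N : Matrix (Fin 2) (Fin 2) (LocalRing L v)).map ev).det := by
    rw [Matrix.det_eq_sign_charpoly_coeff, Matrix.det_eq_sign_charpoly_coeff, hc]
  have htr : ((M : Matrix (Fin 2) (Fin 2) (LocalRing L v)).map ev).trace = ((N : Matrix (Fin 2) (Fin 2) (LocalRing L v)).map ev).trace := by
    rw [Matrix.trace_eq_neg_charpoly_coeff, Matrix.trace_eq_neg_charpoly_coeff, hc]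
  have hdM : ((M : Matrix (Fin 2) (Fin 2) (LocalRing L v)).map ev).det = ev (M : Matrix (Fin 2) (Fin 2) (LocalRing L v)).det := by
    rw [← RingHom.mapMatrix_apply, ← RingHom.map_det]
  have hdN : ((N : Matrix (Fin 2) (Fin 2) (LocalRing L v)).map ev).det = ev (N : Matrix (Fin 2) (Fin 2) (LocalRing L v)).det := by
    rw [← RingHom.mapMatrix_apply, ← RingHom.map_det]
  have htM : ((M : Matrix (Fin 2) (Fin 2) (LocalRing L v)).map ev).trace = ev (M : Matrix (Fin 2) (Fin 2) (LocalRing L v)).trace := by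
    rw [Matrix.trace, Matrix.trace, map_sum]; rfl
  have htN : ((N : Matrix (Fin 2) (Fin 2) (LocalRing L v)).map ev).trace = ev (N : Matrix (Fin 2) (Fin 2) (LocalRing L v)).trace := by
    rw [Matrix.trace, Matrix.trace, map_sum]; rfl
  rw [← hdM, ← hdN, ← htM, ← htN, hdet, htr]

/-- ON is a class function on `U(Φ₂)_v`: `|det (y h₂ y⁻¹)|_w < |tr (y h₂ y⁻¹)|_w² ↔ |det h₂|_w < |tr h₂|_w²`. [cite: Rogawski1990, §3.1 p. 19; §4.9 p. 56] -/
theorem valued_det_lt_trace_sq_conj_iff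
    (y h : (cmDatum L 2 (Matrix.of fun i j : Fin 2 => if i.val + j.val + 1 = 2 then (1 : L) else 0)).Local v) :
    Valued.v ((Pi.evalRingHom (fun w' : PlacesOver L v => w'.1.adicCompletion L) w) (((y * h * y⁻¹).val : GL (Fin 2) (LocalRing L v)) : Matrix (Fin 2) (Fin 2) (LocalRing L v)).det) <
        Valued.v ((Pi.evalRingHom (fun w' : PlacesOver L v => w'.1.adicCompletion L) w) (((y * h * y⁻¹).val : GL (Fin 2) (LocalRing L v)) : Matrix (Fin 2) (Fin 2) (LocalRing L v)).trace) ^ 2 ↔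
      Valued.v ((Pi.evalRingHom (fun w' : PlacesOver L v => w'.1.adicCompletion L) w) ((h.val : GL (Fin 2) (LocalRing L v)) : Matrix (Fin 2) (Fin 2) (LocalRing L v)).det) <
        Valued.v ((Pi.evalRingHom (fun w' : PlacesOver L v => w'.1.adicCompletion L) w) ((h.val : GL (Fin 2) (LocalRing L v)) : Matrix (Fin 2) (Fin 2) (LocalRing L v)).trace) ^ 2 :=
  valued_det_lt_trace_sq_iff_of_charpoly_eq L v w ((isStablyConj_of_isConj (isConj_iff.2 ⟨y, rfl⟩)).charpoly_eq).symm

/-- ON is invariant under STABLE conjugacy in `H_v` (equal characteristic polynomials of the `U(Φ₂)`-components, ★ `IsStablyConj.charpoly_eq`).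
[cite: Rogawski1990, §3.1 p. 19; §4.9 p. 56] -/
theorem valued_det_lt_trace_sq_of_isLocalStablyConjH_iff
    {γH δ : (cmDatum L 2 (Matrix.of fun i j : Fin 2 => if i.val + j.val + 1 = 2 then (1 : L) else 0)).Local v ×
      (cmDatum L 1 (Matrix.of fun i j : Fin 1 => if i.val + j.val + 1 = 1 then (1 : L) else 0)).Local v}
    (hst : IsLocalStablyConjH L v γH δ) :
    Valued.v ((Pi.evalRingHom (fun w' : PlacesOver L v => w'.1.adicCompletion L) w) ((γH.1.val : GL (Fin 2) (LocalRing L v)) : Matrix (Fin 2) (Fin 2) (LocalRing L v)).det) <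
        Valued.v ((Pi.evalRingHom (fun w' : PlacesOver L v => w'.1.adicCompletion L) w) ((γH.1.val : GL (Fin 2) (LocalRing L v)) : Matrix (Fin 2) (Fin 2) (LocalRing L v)).trace) ^ 2 ↔
      Valued.v ((Pi.evalRingHom (fun w' : PlacesOver L v => w'.1.adicCompletion L) w) ((δ.1.val : GL (Fin 2) (LocalRing L v)) : Matrix (Fin 2) (Fin 2) (LocalRing L v)).det) <
        Valued.v ((Pi.evalRingHom (fun w' : PlacesOver L v => w'.1.adicCompletion L) w) ((δ.1.val : GL (Fin 2) (LocalRing L v)) : Matrix (Fin 2) (Fin 2) (LocalRing L v)).trace) ^ 2 :=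
  valued_det_lt_trace_sq_iff_of_charpoly_eq L v w hst.1.charpoly_eq

/-! ## §2 «hoffH» and the reduction to the ON-stratum identity, for an `f^H` supported ON the stratum -/

/-- **«hoffH′».**  If every point of `tsupport f^H` is ON (`|det x₂|_w < |tr x₂|_w²`) and `γ_H` is OFF, then for every class `c` of `H_v` stably conjugate to `γ_H` and every
`x ∈ H_v`: `x · out c · x⁻¹ ∉ tsupport f^H` (§1). [cite: Rogawski1990, §3.1 p. 19; §4.3 p. 43; §12.7 L. 12.7.3 (proof) p. 195] -/
theorem conj_notMem_tsupport_of_not_on_H'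
    (fH : ((cmDatum L 2 (Matrix.of fun i j : Fin 2 => if i.val + j.val + 1 = 2 then (1 : L) else 0)).Local v ×
      (cmDatum L 1 (Matrix.of fun i j : Fin 1 => if i.val + j.val + 1 = 1 then (1 : L) else 0)).Local v) → ℂ)
    (hfHon : ∀ x ∈ tsupport fH,
      Valued.v ((Pi.evalRingHom (fun w' : PlacesOver L v => w'.1.adicCompletion L) w) ((x.1.val : GL (Fin 2) (LocalRing L v)) : Matrix (Fin 2) (Fin 2) (LocalRing L v)).det) <
        Valued.v ((Pi.evalRingHom (fun w' : PlacesOver L v => w'.1.adicCompletion L) w) ((x.1.val : GL (Fin 2) (LocalRing L v)) : Matrix (Fin 2) (Fin 2) (LocalRing L v)).trace) ^ 2)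
    (γH : ((cmDatum L 2 (Matrix.of fun i j : Fin 2 => if i.val + j.val + 1 = 2 then (1 : L) else 0)).Local v ×
      (cmDatum L 1 (Matrix.of fun i j : Fin 1 => if i.val + j.val + 1 = 1 then (1 : L) else 0)).Local v))
    (hoff : ¬ (Valued.v ((Pi.evalRingHom (fun w' : PlacesOver L v => w'.1.adicCompletion L) w) ((γH.1.val : GL (Fin 2) (LocalRing L v)) : Matrix (Fin 2) (Fin 2) (LocalRing L v)).det) <
        Valued.v ((Pi.evalRingHom (fun w' : PlacesOver L v => w'.1.adicCompletion L) w) ((γH.1.val : GL (Fin 2) (LocalRing L v)) : Matrix (Fin 2) (Fin 2) (LocalRing L v)).trace) ^ 2))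
    (c : ConjClasses ((cmDatum L 2 (Matrix.of fun i j : Fin 2 => if i.val + j.val + 1 = 2 then (1 : L) else 0)).Local v ×
      (cmDatum L 1 (Matrix.of fun i j : Fin 1 => if i.val + j.val + 1 = 1 then (1 : L) else 0)).Local v))
    (hst : IsLocalStablyConjH L v γH (Quotient.out c))
    (x : ((cmDatum L 2 (Matrix.of fun i j : Fin 2 => if i.val + j.val + 1 = 2 then (1 : L) else 0)).Local v ×
      (cmDatum L 1 (Matrix.of fun i j : Fin 1 => if i.val + j.val + 1 = 1 then (1 : L) else 0)).Local v)) :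
    x * Quotient.out c * x⁻¹ ∉ tsupport fH := by
  intro hx
  have hon := hfHon _ hx
  rw [Prod.fst_mul, Prod.fst_mul, Prod.fst_inv, valued_det_lt_trace_sq_conj_iff L v w] at hon
  exact hoff ((valued_det_lt_trace_sq_of_isLocalStablyConjH_iff L v w hst).2 hon)

set_option maxHeartbeats 1600000 in  -- statement-level `whnf` on the CM carriers
/-- **D3 ⇐ D3-iv, multi-shell form.**  `G`-side data as in ★ `isLocalDeltaTransfer_of_on` (`K_n` of level `r < 1` under `E₃`, `E₃ z = β·1`, `|β| = 1`, `E₃ a = diag(α, 1, (σ_w α)⁻¹)`,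
`0 < |α| < 1`, `m ≥ 1`, `tsupport f ⊆ K_n (z aᵐ) K_n`), a transfer factor `T`, families `mH, mG`, and an `f^H` all of whose support is ON the stratum (`hfHon`).  If the transfer identity
holds at every `G`-regular `γ_H` ON the stratum, then ★ `IsLocalDeltaTransfer L Φ₃ v T mH mG f^H f`. [cite: Rogawski1990, §4.3 (4.3.1) p. 43; §12.7 L. 12.7.3 (proof) p. 195] -/
theorem isLocalDeltaTransfer_of_on'
    (Kn : Subgroup ((cmDatum L 3 (qsForm L)).Local v)) {r : WithZero (Multiplicative ℤ)} (hr : r < 1)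
    (hK : ∀ k ∈ Kn, ∀ i j, Valued.v ((((localNonsplitEquiv (IsCMField.complexConj L) (qsForm L) (IsCMField.complexConj_ne_one L) w hw k :
        ↥(unitaryGroupOfForm (galAdicCompletionMap (L := L) (IsCMField.complexConj L) hw) (placeForm (qsForm L) w.1))) :
        GL (Fin 3) (w.1.adicCompletion L)) : Matrix (Fin 3) (Fin 3) (w.1.adicCompletion L)) i j - (1 : Matrix (Fin 3) (Fin 3) (w.1.adicCompletion L)) i j) ≤ r)
    {z a : (cmDatum L 3 (qsForm L)).Local v} {β α : w.1.adicCompletion L}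
    (hz : (((localNonsplitEquiv (IsCMField.complexConj L) (qsForm L) (IsCMField.complexConj_ne_one L) w hw z :
        ↥(unitaryGroupOfForm (galAdicCompletionMap (L := L) (IsCMField.complexConj L) hw) (placeForm (qsForm L) w.1))) :
        GL (Fin 3) (w.1.adicCompletion L)) : Matrix (Fin 3) (Fin 3) (w.1.adicCompletion L)) = β • (1 : Matrix (Fin 3) (Fin 3) (w.1.adicCompletion L)))
    (hβ : Valued.v β = 1)
    (ha : (((localNonsplitEquiv (IsCMField.complexConj L) (qsForm L) (IsCMField.complexConj_ne_one L) w hw a :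
        ↥(unitaryGroupOfForm (galAdicCompletionMap (L := L) (IsCMField.complexConj L) hw) (placeForm (qsForm L) w.1))) :
        GL (Fin 3) (w.1.adicCompletion L)) : Matrix (Fin 3) (Fin 3) (w.1.adicCompletion L)) =
        Matrix.diagonal ![α, 1, ((galAdicCompletionMap (L := L) (IsCMField.complexConj L) hw) α)⁻¹])
    (hα0 : α ≠ 0) (hα1 : Valued.v α < 1) {m : ℕ} (hm : 1 ≤ m)
    [∀ γ : (cmDatum L 3 (qsForm L)).Local v, MeasurableSpace ((cmDatum L 3 (qsForm L)).Local v ⧸ Subgroup.centralizer ({γ} : Set ((cmDatum L 3 (qsForm L)).Local v)))]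
    [∀ aH : ((cmDatum L 2 (Matrix.of fun i j : Fin 2 => if i.val + j.val + 1 = 2 then (1 : L) else 0)).Local v × (cmDatum L 1 (Matrix.of fun i j : Fin 1 => if i.val + j.val + 1 = 1 then (1 : L) else 0)).Local v),
      MeasurableSpace (((cmDatum L 2 (Matrix.of fun i j : Fin 2 => if i.val + j.val + 1 = 2 then (1 : L) else 0)).Local v × (cmDatum L 1 (Matrix.of fun i j : Fin 1 => if i.val + j.val + 1 = 1 then (1 : L) else 0)).Local v) ⧸
        Subgroup.centralizer ({aH} : Set ((cmDatum L 2 (Matrix.of fun i j : Fin 2 => if i.val + j.val + 1 = 2 then (1 : L) else 0)).Local v × (cmDatum L 1 (Matrix.of fun i j : Fin 1 => if i.val + j.val + 1 = 1 then (1 : L) else 0)).Local v)))]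
    (T : LocalTransferFactor L (qsForm L) v)
    (mH : OrbitalMeasureFamily ((cmDatum L 2 (Matrix.of fun i j : Fin 2 => if i.val + j.val + 1 = 2 then (1 : L) else 0)).Local v ×
      (cmDatum L 1 (Matrix.of fun i j : Fin 1 => if i.val + j.val + 1 = 1 then (1 : L) else 0)).Local v))
    (mG : OrbitalMeasureFamily ((cmDatum L 3 (qsForm L)).Local v))
    (fH : ((cmDatum L 2 (Matrix.of fun i j : Fin 2 => if i.val + j.val + 1 = 2 then (1 : L) else 0)).Local v ×
      (cmDatum L 1 (Matrix.of fun i j : Fin 1 => if i.val + j.val + 1 = 1 then (1 : L) else 0)).Local v) → ℂ)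
    (hfHon : ∀ x ∈ tsupport fH,
      Valued.v ((Pi.evalRingHom (fun w' : PlacesOver L v => w'.1.adicCompletion L) w) ((x.1.val : GL (Fin 2) (LocalRing L v)) : Matrix (Fin 2) (Fin 2) (LocalRing L v)).det) <
        Valued.v ((Pi.evalRingHom (fun w' : PlacesOver L v => w'.1.adicCompletion L) w) ((x.1.val : GL (Fin 2) (LocalRing L v)) : Matrix (Fin 2) (Fin 2) (LocalRing L v)).trace) ^ 2)
    (f : (cmDatum L 3 (qsForm L)).Local v → ℂ)
    (hf : tsupport f ⊆ DoubleCoset.doubleCoset (z * a ^ m) (Kn : Set ((cmDatum L 3 (qsForm L)).Local v)) Kn)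
    (hon : ∀ γH : ((cmDatum L 2 (Matrix.of fun i j : Fin 2 => if i.val + j.val + 1 = 2 then (1 : L) else 0)).Local v × (cmDatum L 1 (Matrix.of fun i j : Fin 1 => if i.val + j.val + 1 = 1 then (1 : L) else 0)).Local v),
      IsLocalGRegular L v γH → Valued.v ((Pi.evalRingHom (fun w' : PlacesOver L v => w'.1.adicCompletion L) w) ((γH.1.val : GL (Fin 2) (LocalRing L v)) : Matrix (Fin 2) (Fin 2) (LocalRing L v)).det) <
        Valued.v ((Pi.evalRingHom (fun w' : PlacesOver L v => w'.1.adicCompletion L) w) ((γH.1.val : GL (Fin 2) (LocalRing L v)) : Matrix (Fin 2) (Fin 2) (LocalRing L v)).trace) ^ 2 →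
      stableOrbitalIntegralRel (IsLocalStablyConjH L v) mH fH γH = ∑ᶠ c : ConjClasses ((cmDatum L 3 (qsForm L)).Local v), T.Δ γH (Quotient.out c) * classOrbitalIntegral mG f c) :
    IsLocalDeltaTransfer L (qsForm L) v T mH mG fH f :=
  F0P3cStCharTSTransferVanish.isDeltaTransferRel_of_on_off (IsLocalStablyConjH L v) (IsLocalGRegular L v)
    (fun γH : ((cmDatum L 2 (Matrix.of fun i j : Fin 2 => if i.val + j.val + 1 = 2 then (1 : L) else 0)).Local v × (cmDatum L 1 (Matrix.of fun i j : Fin 1 => if i.val + j.val + 1 = 1 then (1 : L) else 0)).Local v) =>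
      Valued.v ((Pi.evalRingHom (fun w' : PlacesOver L v => w'.1.adicCompletion L) w) ((γH.1.val : GL (Fin 2) (LocalRing L v)) : Matrix (Fin 2) (Fin 2) (LocalRing L v)).det) <
        Valued.v ((Pi.evalRingHom (fun w' : PlacesOver L v => w'.1.adicCompletion L) w) ((γH.1.val : GL (Fin 2) (LocalRing L v)) : Matrix (Fin 2) (Fin 2) (LocalRing L v)).trace) ^ 2)
    T mH mG fH f hon
    (fun γH _ hoff c hst x => conj_notMem_tsupport_of_not_on_H' L v w fH hfHon γH hoff c hst x)
    (fun γH _ hoff c hΔ x => F0P3cStCharTSOffStratumCM.conj_notMem_tsupport_of_not_on_G L v w hw Kn hr hK hz hβ ha hα0 hα1 hm T f hf γH hoff c hΔ x)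

/-! ## §3 The Levi form -/

set_option maxHeartbeats 1600000 in  -- statement-level `whnf` on the CM carriers
/-- **D3 ⇐ THE LEVI IDENTITY, multi-shell form.**  As ★ `isLocalDeltaTransfer_of_levi` (p849563) with the single-shell clause on `f^H` replaced by `hfHon` (every point of
`tsupport f^H` ON): the Δ-transfer of `(f^H, f)` follows from the `hlevi` identity at the hyperbolic `G`-regular diagonal-Levi points — the socket of ★ `hlevi_of_closed_forms`.
[cite: Rogawski1990, §4.3 (4.3.1) p. 43; §4.9 p. 56; §12.7 L. 12.7.3 (proof) p. 195] -/
theorem isLocalDeltaTransfer_of_levi'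
    (Kn : Subgroup ((cmDatum L 3 (qsForm L)).Local v)) {r : WithZero (Multiplicative ℤ)} (hr : r < 1)
    (hK : ∀ k ∈ Kn, ∀ i j, Valued.v ((((localNonsplitEquiv (IsCMField.complexConj L) (qsForm L) (IsCMField.complexConj_ne_one L) w hw k :
        ↥(unitaryGroupOfForm (galAdicCompletionMap (L := L) (IsCMField.complexConj L) hw) (placeForm (qsForm L) w.1))) :
        GL (Fin 3) (w.1.adicCompletion L)) : Matrix (Fin 3) (Fin 3) (w.1.adicCompletion L)) i j - (1 : Matrix (Fin 3) (Fin 3) (w.1.adicCompletion L)) i j) ≤ r)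
    {z a : (cmDatum L 3 (qsForm L)).Local v} {β α : w.1.adicCompletion L}
    (hz : (((localNonsplitEquiv (IsCMField.complexConj L) (qsForm L) (IsCMField.complexConj_ne_one L) w hw z :
        ↥(unitaryGroupOfForm (galAdicCompletionMap (L := L) (IsCMField.complexConj L) hw) (placeForm (qsForm L) w.1))) :
        GL (Fin 3) (w.1.adicCompletion L)) : Matrix (Fin 3) (Fin 3) (w.1.adicCompletion L)) = β • (1 : Matrix (Fin 3) (Fin 3) (w.1.adicCompletion L)))
    (hβ : Valued.v β = 1)
    (ha : (((localNonsplitEquiv (IsCMField.complexConj L) (qsForm L) (IsCMField.complexConj_ne_one L) w hw a :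
        ↥(unitaryGroupOfForm (galAdicCompletionMap (L := L) (IsCMField.complexConj L) hw) (placeForm (qsForm L) w.1))) :
        GL (Fin 3) (w.1.adicCompletion L)) : Matrix (Fin 3) (Fin 3) (w.1.adicCompletion L)) =
        Matrix.diagonal ![α, 1, ((galAdicCompletionMap (L := L) (IsCMField.complexConj L) hw) α)⁻¹])
    (hα0 : α ≠ 0) (hα1 : Valued.v α < 1) {m : ℕ} (hm : 1 ≤ m)
    [∀ γ : (cmDatum L 3 (qsForm L)).Local v, MeasurableSpace ((cmDatum L 3 (qsForm L)).Local v ⧸ Subgroup.centralizer ({γ} : Set ((cmDatum L 3 (qsForm L)).Local v)))]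
    [∀ aH : ((cmDatum L 2 (Matrix.of fun i j : Fin 2 => if i.val + j.val + 1 = 2 then (1 : L) else 0)).Local v × (cmDatum L 1 (Matrix.of fun i j : Fin 1 => if i.val + j.val + 1 = 1 then (1 : L) else 0)).Local v),
      MeasurableSpace (((cmDatum L 2 (Matrix.of fun i j : Fin 2 => if i.val + j.val + 1 = 2 then (1 : L) else 0)).Local v × (cmDatum L 1 (Matrix.of fun i j : Fin 1 => if i.val + j.val + 1 = 1 then (1 : L) else 0)).Local v) ⧸
        Subgroup.centralizer ({aH} : Set ((cmDatum L 2 (Matrix.of fun i j : Fin 2 => if i.val + j.val + 1 = 2 then (1 : L) else 0)).Local v × (cmDatum L 1 (Matrix.of fun i j : Fin 1 => if i.val + j.val + 1 = 1 then (1 : L) else 0)).Local v)))]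
    (T : LocalTransferFactor L (qsForm L) v)
    (mH : OrbitalMeasureFamily ((cmDatum L 2 (Matrix.of fun i j : Fin 2 => if i.val + j.val + 1 = 2 then (1 : L) else 0)).Local v ×
      (cmDatum L 1 (Matrix.of fun i j : Fin 1 => if i.val + j.val + 1 = 1 then (1 : L) else 0)).Local v))
    (mG : OrbitalMeasureFamily ((cmDatum L 3 (qsForm L)).Local v))
    (fH : ((cmDatum L 2 (Matrix.of fun i j : Fin 2 => if i.val + j.val + 1 = 2 then (1 : L) else 0)).Local v ×
      (cmDatum L 1 (Matrix.of fun i j : Fin 1 => if i.val + j.val + 1 = 1 then (1 : L) else 0)).Local v) → ℂ)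
    (hfHon : ∀ x ∈ tsupport fH,
      Valued.v ((Pi.evalRingHom (fun w' : PlacesOver L v => w'.1.adicCompletion L) w) ((x.1.val : GL (Fin 2) (LocalRing L v)) : Matrix (Fin 2) (Fin 2) (LocalRing L v)).det) <
        Valued.v ((Pi.evalRingHom (fun w' : PlacesOver L v => w'.1.adicCompletion L) w) ((x.1.val : GL (Fin 2) (LocalRing L v)) : Matrix (Fin 2) (Fin 2) (LocalRing L v)).trace) ^ 2)
    (f : (cmDatum L 3 (qsForm L)).Local v → ℂ)
    (hf : tsupport f ⊆ DoubleCoset.doubleCoset (z * a ^ m) (Kn : Set ((cmDatum L 3 (qsForm L)).Local v)) Kn)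
    (hlevi : ∀ (γH : ((cmDatum L 2 (Matrix.of fun i j : Fin 2 => if i.val + j.val + 1 = 2 then (1 : L) else 0)).Local v × (cmDatum L 1 (Matrix.of fun i j : Fin 1 => if i.val + j.val + 1 = 1 then (1 : L) else 0)).Local v)) (d' : Fin 2 → (LocalRing L v)ˣ),
      glDiagonal 2 (LocalRing L v) d' = ((γH.1).val : GL (Fin 2) (LocalRing L v)) → IsLocalGRegular L v γH →
      Valued.v (((d' 1 : (LocalRing L v)ˣ) : LocalRing L v) w) < Valued.v (((d' 0 : (LocalRing L v)ˣ) : LocalRing L v) w) →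
      galAdicCompletionMap (L := L) (IsCMField.complexConj L) hw (((d' 0 : (LocalRing L v)ˣ) : LocalRing L v) w) * ((d' 1 : (LocalRing L v)ˣ) : LocalRing L v) w = 1 →
      classOrbitalIntegral mH fH (ConjClasses.mk γH) = ∑ᶠ c : ConjClasses ((cmDatum L 3 (qsForm L)).Local v), T.Δ γH (Quotient.out c) * classOrbitalIntegral mG f c) :
    IsLocalDeltaTransfer L (qsForm L) v T mH mG fH f :=
  isLocalDeltaTransfer_of_on' L v w hw Kn hr hK hz hβ ha hα0 hα1 hm T mH mG fH hfHon f hf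
    (fun γH hreg hon => F0P3cStCharTSTransferOfLevi.hon_of_levi L v w hw T mH mG fH f hlevi γH hreg hon)

end Summit.HodgeConjecture.HodgeConjecture.Cruxes.H413.F0P3cStCharTSOffStratumSum

end
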